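import Summits.ResolutionOfSingularities.ResolutionOfSingularities.Theses.RisoStrata
import Literature.AlgebraicGeometry.Resolution.RegularLocalRingsNormal

/-!
# Crux `RisoCentresResolve` (stmt-ResolutionOfSingularities-18546) — negative lemma "bounded letters are
# not enough", part 3/4: inert steps and the non-regular cusp over `k'`

Support file of `RisoCentresResolveFalseWithBoundedLetters` (route `ResolutionOfSingularities/RisoStrata`,
crux `RisoCentresResolve`).
* `bddLetters_foldl_fixed`: with the admissible unit choice `x_t = 1` a step `B ↦ k[B ∪ Cen·1⁻¹]` of the
  crux's tower is the identity, so folding over any schedule returns the start chart.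
* `bddLetters_not_regular`: for a `k`-subalgebra `B₀ ⊆ k'(X)` of polynomials `f ∈ k'[X]` with `f'(0) = 0`
  containing `X², X³`, the crux's `loc O B₀` at the `X`-adic valuation ring `O` is NOT a regular local
  ring (regular ⇒ integrally closed, tree theorem `isIntegrallyClosed_of_isRegularLocalRing`,
  Matsumura 19.4; `(X³/X²)² = X²` but `X ∉ loc O B₀` by the functional `f ↦ f'(0)`) — the argument of
  `risoCentresResolve_false_without_blowups`, run over an arbitrary base field `k' ⊇ k`.
No definitions; kernel-only.
-/

set_option linter.dupNamespace false

namespace Summit.ResolutionOfSingularities.ResolutionOfSingularities.Theorems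

open Polynomial

section Engine

variable {k K : Type} [Field k] [Field K] [Algebra k K]

/-- With the constant unit choice `x_t = 1`, every step of the crux's tower is the identity: folding
`B ↦ k[B ∪ F B de]` with `F B de ⊆ B` over any list returns the start chart. [folklore] -/
theorem bddLetters_foldl_fixed (F : Subalgebra k K → ℕ × ℕ → Set K) (hF : ∀ B de, F B de ⊆ B)
    (B₀ : Subalgebra k K) (L : List (ℕ × ℕ)) :
    List.foldl (fun B de => Algebra.adjoin k ((B : Set K) ∪ F B de)) B₀ L = B₀ := by
  refine List.foldl_fixed' (fun de => ?_) L
  apply le_antisymm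
  · refine Algebra.adjoin_le ?_
    rintro y (hy | hy)
    · exact hy
    · exact hF _ _ hy
  · exact fun y hy => Algebra.subset_adjoin (Or.inl hy)

end Engine

section NotRegular

variable {k k' : Type} [Field k] [Field k'] [Algebra k k']

/-- Leibniz rule for the functional `f ↦ f'(0)` (the coefficient of `X`). [folklore] -/
theorem bddLetters_D_mul (f g : k'[X]) : (derivative (f * g)).coeff 0 =
    (derivative f).coeff 0 * g.coeff 0 + f.coeff 0 * (derivative g).coeff 0 := by
  simp [derivative_mul, mul_coeff_zero]

/-- `(Xⁿ)'(0) = 0` for `n ≥ 2`. [folklore] -/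
theorem bddLetters_D_X_pow (n : ℕ) (hn : 2 ≤ n) : (derivative ((X : k'[X]) ^ n)).coeff 0 = 0 := by
  obtain ⟨m, rfl⟩ := Nat.exists_eq_add_of_le hn
  simp [derivative_X_pow, coeff_X_pow]
  intro h; omega

/-- `(X·g)'(0) = g(0)`. [folklore] -/
theorem bddLetters_D_X_mul (g : k'[X]) : (derivative (X * g)).coeff 0 = g.coeff 0 := by
  simp [derivative_mul, mul_coeff_zero]

/-- **The cusp over `k'` is not regular.** For a `k`-subalgebra `B₀ ⊆ k'(X)` consisting of polynomials
`f ∈ k'[X]` with `f'(0) = 0` and containing `X², X³`, the localisation `loc O B₀` of the crux at the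
`X`-adic valuation ring `O` is not a regular local ring: regular ⇒ integrally closed (tree theorem
`isIntegrallyClosed_of_isRegularLocalRing`, Matsumura 19.4) ⇒ `X = X³/X² ∈ loc O B₀`, but every element
of `loc O B₀` is `f/g` with `f'(0) = g'(0) = 0 ≠ g(0)` and `X·g = f` forces `g(0) = f'(0) = 0`.
(The argument of `risoCentresResolve_false_without_blowups`, over the base field `k'`.) [folklore] -/
theorem bddLetters_not_regular (B₀ : Subalgebra k (RatFunc k'))
    (hB₀ : ∀ a ∈ B₀, ∃ f : k'[X], (derivative f).coeff 0 = 0 ∧ a = algebraMap k'[X] (RatFunc k') f)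
    (hT2 : (RatFunc.X : RatFunc k') ^ 2 ∈ B₀) (hT3 : (RatFunc.X : RatFunc k') ^ 3 ∈ B₀) :
    ¬ IsRegularLocalRing ↥(Algebra.adjoin k {y | ∃ a ∈ B₀, ∃ s ∈ B₀,
      s⁻¹ ∈ ((Polynomial.idealX k').valuation (RatFunc k')).valuationSubring ∧ y = a * s⁻¹}) := by
  intro hreg
  let K : Type := RatFunc k'
  let T : K := RatFunc.X
  have hT0 : T ≠ 0 := RatFunc.X_ne_zero
  let v := (Polynomial.idealX k').valuation K
  let O : ValuationSubring K := v.valuationSubring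
  set L : Subalgebra k K :=
    Algebra.adjoin k {y | ∃ a ∈ B₀, ∃ s ∈ B₀, s⁻¹ ∈ O ∧ y = a * s⁻¹} with hL
  change IsRegularLocalRing ↥L at hreg
  have hT : T = algebraMap k'[X] K Polynomial.X := (RatFunc.algebraMap_X).symm
  have hB₀L : B₀ ≤ L := by
    intro y hy
    refine Algebra.subset_adjoin ⟨y, hy, 1, one_mem B₀, ?_, ?_⟩
    · rw [inv_one]; exact one_mem O
    · rw [inv_one, mul_one]
  -- the subalgebra of fractions `f/g` with `f'(0) = g'(0) = 0 ≠ g(0)`: contains `L`, not `X`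
  let M : Subalgebra k K :=
    { carrier := {y | ∃ f g : k'[X], (derivative f).coeff 0 = 0 ∧ (derivative g).coeff 0 = 0 ∧
        g.coeff 0 ≠ 0 ∧ y = algebraMap k'[X] K f / algebraMap k'[X] K g}
      mul_mem' := by
        rintro _ _ ⟨f₁, g₁, hf₁, hg₁, hg₁0, rfl⟩ ⟨f₂, g₂, hf₂, hg₂, hg₂0, rfl⟩
        refine ⟨f₁ * f₂, g₁ * g₂, ?_, ?_, ?_, ?_⟩
        · rw [bddLetters_D_mul, hf₁, hf₂]; ring
        · rw [bddLetters_D_mul, hg₁, hg₂]; ring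
        · rw [mul_coeff_zero]; exact mul_ne_zero hg₁0 hg₂0
        · rw [map_mul, map_mul, div_mul_div_comm]
      add_mem' := by
        rintro _ _ ⟨f₁, g₁, hf₁, hg₁, hg₁0, rfl⟩ ⟨f₂, g₂, hf₂, hg₂, hg₂0, rfl⟩
        have h1 : algebraMap k'[X] K g₁ ≠ 0 :=
          (map_ne_zero_iff _ (IsFractionRing.injective k'[X] K)).mpr
            (fun h => hg₁0 (by rw [h, coeff_zero]))
        have h2 : algebraMap k'[X] K g₂ ≠ 0 :=
          (map_ne_zero_iff _ (IsFractionRing.injective k'[X] K)).mpr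
            (fun h => hg₂0 (by rw [h, coeff_zero]))
        refine ⟨f₁ * g₂ + g₁ * f₂, g₁ * g₂, ?_, ?_, ?_, ?_⟩
        · rw [derivative_add, coeff_add, bddLetters_D_mul, bddLetters_D_mul, hf₁, hg₁, hf₂, hg₂]; ring
        · rw [bddLetters_D_mul, hg₁, hg₂]; ring
        · rw [mul_coeff_zero]; exact mul_ne_zero hg₁0 hg₂0
        · rw [map_add, map_mul, map_mul, map_mul, div_add_div _ _ h1 h2]
      algebraMap_mem' := by
        intro c
        refine ⟨C (algebraMap k k' c), 1, by simp, by simp, by simp, ?_⟩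
        rw [map_one, div_one, IsScalarTower.algebraMap_apply k k'[X] K, Polynomial.algebraMap_apply] }
  have hXM : T ∉ M := by
    rintro ⟨f, g, hf, -, hg0, hX⟩
    have hg : algebraMap k'[X] K g ≠ 0 :=
      (map_ne_zero_iff _ (IsFractionRing.injective k'[X] K)).mpr (fun h => hg0 (by rw [h, coeff_zero]))
    have hXg : algebraMap k'[X] K (X * g) = algebraMap k'[X] K f := by
      rw [map_mul, ← hT, hX, div_mul_cancel₀ _ hg]
    have := congrArg (fun q : k'[X] => (derivative q).coeff 0) (IsFractionRing.injective k'[X] K hXg)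
    simp only [bddLetters_D_X_mul, hf] at this
    exact hg0 this
  have hLM : L ≤ M := by
    rw [hL]
    refine Algebra.adjoin_le ?_
    rintro _ ⟨a, ha, s, hs, hsO, rfl⟩
    obtain ⟨f, hf, rfl⟩ := hB₀ a ha
    obtain ⟨g, hg, rfl⟩ := hB₀ s hs
    by_cases hg0 : g = 0
    · rw [hg0, map_zero, inv_zero, mul_zero]; exact zero_mem _
    have hgK : algebraMap k'[X] K g ≠ 0 :=
      (map_ne_zero_iff _ (IsFractionRing.injective k'[X] K)).mpr hg0
    have hv1 : v (algebraMap k'[X] K g) = 1 := by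
      have hle1 : v (algebraMap k'[X] K g) ≤ 1 :=
        IsDedekindDomain.HeightOneSpectrum.valuation_le_one _ g
      have hinv : (v (algebraMap k'[X] K g))⁻¹ ≤ 1 := by
        rw [← map_inv₀]; exact (Valuation.mem_valuationSubring_iff v _).mp hsO
      have hne : v (algebraMap k'[X] K g) ≠ 0 := (Valuation.ne_zero_iff v).mpr hgK
      exact le_antisymm hle1 (by rwa [inv_le_one₀ (zero_lt_iff.mpr hne)] at hinv)
    have hcoeff : g.coeff 0 ≠ 0 := by
      have hnot : g ∉ (Polynomial.idealX k').asIdeal :=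
        (IsDedekindDomain.HeightOneSpectrum.valuation_eq_one_iff_notMem (K := K)
          (Polynomial.idealX k')).mp hv1
      rw [Polynomial.idealX_span, Ideal.mem_span_singleton, Polynomial.X_dvd_iff] at hnot
      exact hnot
    exact ⟨f, g, hf, hg, hcoeff, by rw [div_eq_mul_inv]⟩
  have hXL : T ∉ L := fun hx => hXM (hLM hx)
  -- regular ⇒ integrally closed ⇒ `X = X³/X² ∈ L`
  haveI : IsRegularLocalRing ↥L := hreg
  have hic : IsIntegrallyClosed ↥L :=
    Literature.AlgebraicGeometry.Resolution.isIntegrallyClosed_of_isRegularLocalRing ↥L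
  let a₂ : ↥L := ⟨T ^ 2, hB₀L hT2⟩
  let a₃ : ↥L := ⟨T ^ 3, hB₀L hT3⟩
  have ha₂0 : a₂ ≠ 0 := by
    intro h0
    have : (a₂ : K) = 0 := by rw [h0]; rfl
    exact pow_ne_zero 2 hT0 this
  have hrel : a₃ ^ 2 = a₂ ^ 3 := by
    apply Subtype.ext
    change (T ^ 3) ^ 2 = (T ^ 2) ^ 3
    ring
  let F := FractionRing ↥L
  have ha₂F : algebraMap (↥L) F a₂ ≠ 0 :=
    (map_ne_zero_iff _ (IsFractionRing.injective (↥L) F)).mpr ha₂0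
  let zz : F := algebraMap (↥L) F a₃ / algebraMap (↥L) F a₂
  have hz2 : zz ^ 2 = algebraMap (↥L) F a₂ := by
    change (algebraMap (↥L) F a₃ / algebraMap (↥L) F a₂) ^ 2 = _
    rw [div_pow, ← map_pow, hrel, map_pow, pow_succ, mul_div_cancel_left₀ _ (pow_ne_zero 2 ha₂F)]
  have hzint : IsIntegral (↥L) zz := by
    refine ⟨Polynomial.X ^ 2 - Polynomial.C a₂, Polynomial.monic_X_pow_sub_C a₂ two_ne_zero, ?_⟩
    simp [hz2]
  obtain ⟨y, hy⟩ := IsIntegrallyClosed.algebraMap_eq_of_integral hzint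
  have hya : y * a₂ = a₃ := by
    apply IsFractionRing.injective (↥L) F
    rw [map_mul, hy]
    change algebraMap (↥L) F a₃ / algebraMap (↥L) F a₂ * algebraMap (↥L) F a₂ = _
    rw [div_mul_cancel₀ _ ha₂F]
  have hyK : (y : K) * T ^ 2 = T ^ 3 := congrArg Subtype.val hya
  have hyT : (y : K) = T := by
    have h2 : (T ^ 2 : K) ≠ 0 := pow_ne_zero 2 hT0
    calc (y : K) = (y : K) * T ^ 2 / T ^ 2 := by rw [mul_div_cancel_right₀ _ h2]
      _ = T ^ 3 / T ^ 2 := by rw [hyK]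
      _ = T := by rw [pow_succ, mul_div_cancel_left₀ _ h2]
  exact hXL (hyT ▸ y.2)

end NotRegular

end Summit.ResolutionOfSingularities.ResolutionOfSingularities.Theorems
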